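import Mathlib
import Literature.MathematicalPhysics.QuantumFieldTheory.Balaban1983to89.B6Prop26Gluing
import Literature.MathematicalPhysics.QuantumFieldTheory.Balaban1983to89.B6Prop27Kernel

/-!
# `Balaban1983to89.B6Ineq2134OffDiag` — T. Bałaban, *Propagators and renormalization transformations for lattice gauge
theories. II*, Commun. Math. Phys. **96** (1984) 223–250 [Balaban1984PropagatorsII], p. 247: the bound **(2.134)**
`|(K_{□,□′}G_{□′}h_{□′}J)(x)| ≤ O(M⁻¹)e^{−½δ₂d(y,y′)}|J|` for the OFF-DIAGONAL pairs □ ≠ □′, DERIVED — as the print says —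
from (2.133), (2.88) and *"the remarks after the inequality (2.68)"*, in the block-majorant language of `…B6RandomWalk` /
`…B6Prop26Gluing`, with the O(M⁻¹) EXPLICIT; kernel-checked

statement-level skeleton of published theorems with citation tags; proofs where landed; nothing here is a claim about the Yang–Mills mass gap

CITATION HEADER (cell `lit-balaban`, HOME `run/shared/lean/pub/lit-balaban/`; unit `lit-balaban-r03` gen 5 = the B6
reader/fold owner; SKELETON row **B6.Eq2.134**; cell gap GAPS G-B6-11 («(2.134) asserted»); Phase-2 kind «implication»
(PHASE2-TARGETS §G.1/G.2(c)); TAKING line HOME/STATUS.md 2026-08-21T05:45Z).  Source held: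
`paper:balaban1984-cmp96-propagators-rt-ii` (journal page = PDF page + 222); pp. 247 [PDF 25], 239 [PDF 17], 238 [PDF 16],
235 [PDF 13] re-read AS IMAGES (`run/shared/lean/pub/pub-balaban/b2b-balaban-ref1/pages/1984-cmp96-propagators-rt-II/…-p0NN-x2.png`).
IMPORTED, NOT MODIFIED: `…B6RandomWalk` (`HasMajorant`, `BlockSupp`, `hasMajorant_mul`, `chain`), `…B6Prop26Gluing` (`mulOp`,
`ind`, `LocalMajorant`, `hasMajorant_sandwich`, `OutLoc`/`InLoc`, `hasMajorant_localise`, and the CONSUMER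
`majorant_R_of_2134` whose hypothesis `h2134` this module produces for □ ≠ □′), `…B6Ineq268` (`mx`, `LevelSep` = (2.60)),
`…B6Lemma21Repaired` (`Ineq263With` = (2.63) with a generic constant), `…B6Prop27Kernel` (`ratioP`, `ratioP_mul_exp_le` =
the power trading of *"the remarks after (2.68)"*), `…B6Eq291Generator` (p02: the index of (2.93) is ζ_{□′}, GAPS entry).

WHAT THE PAPER PRINTS.  p. 247 [PDF 25], verbatim: *"We have |(G_□J)(x)|, |(∇G_□J)(x)| ≤ O(1)[(L^jη)², L^jη]
e^{−δ₂(L^jη)^{−1}dist(Δ,Δ′)}|J|, (2.133) for x ∈ Δ(y), supp J ⊂ Δ(y′), y, y′ ∈ 𝔅∩T_□. Applying the inequalities (2.133),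
(2.88) and the remarks after the inequality (2.68) we obtain |(K_{□,□′}G_{□′}h_{□′}J)(x)| ≤ O(M^{−1})e^{−½δ₂d(y,y′)}|J| (2.134)
for x ∈ Δ(y), supp J ⊂ Δ(y′)"*.  p. 239 [PDF 17]: *"(K_{□,□′}A)_μ(x) = (h_□²(1 − ζ_□)∂P∂*h_{□′}A)_μ(x) (2.93) if □ ≠ □′. …
The function ζ_□ is of the same type as h_□, but it is equal to 1 on a cube containing □ and with a boundary having the
distance 1/3 M to the boundary of □, and it is equal to 0 outside a similar cube with 1/3 M replaced by 2/3 M."* (the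
derivation forces the index ζ_{□′}: `…B6Eq291Generator`, §1′).  p. 238 [PDF 16], (2.88): *"|(∂P∂*)_{μν}(x, x′)| ≤ …
≤ O(1)(L^jη)^{−2}(L^{j′}η)^{−d}e^{−δ₂d(y,y′)}, where x ∈ B^j(y), x′ ∈ B^{j′}(y′), y ∈ Λ_j, y′ ∈ Λ_{j′}"*.  p. 235 [PDF 13],
after (2.68): *"Let us remark that the powers (L^jη)⁴(L^{j′}η)^{−d} in the estimate (2.68) are chosen arbitrarily. … Now
arbitrary powers of L^jη, L^{j′}η can be included also, changing slightly δ₀."*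

THE TYPING (as in the siblings).  Fine lattice `X` with block map `blk : X → 𝔅 = g.Site` (`g : B6.Geometry`: `len y = L^jη`,
`dist` = d(y,y′) of (2.46), `scale`, L, R, M).  ∂P∂* is an operator `DP` on `X → ℝ` with the (2.88)-SHAPE block majorant
`CP·(L^jη)^{−2}·e^{−δ₂d(y,y″)}` (`hP`; the printed POINTWISE form with `(L^{j″}η)^{−d}` gives it through the block volumes,
`hasMajorant_of_kernel288`); `G_{□′}` is an operator `Gl` with the (2.133)-SHAPE LOCAL majorant `CG·(L^{j″}η)²·e^{−δ₂d(y″,y′)}` on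
the reach `S` of □′ (`hG`, d-form as in `…B6Prop26Gluing`); `hI` = h_{□′} (|h| ≤ 1 by (2.36), supported in the blocks of `S`);
`a` = h_□²(1 − ζ_{□′}) (|a| ≤ 1, vanishing on the blocks of the CORE `Score` ⊇ □′ where ζ_{□′} = 1); the printed *"distance
1/3 M"* is the GAP hypothesis `hgap : y ∉ Score → y″ ∈ S → m·M ≤ d(y,y″)`.

WHAT IS PROVED (0 `sorry`, 0 definitions, 0 named facts; axioms = the standard three; every constant explicit).
§1 `term_le` — ONE y″-TERM: for d(y,y″) ≥ m·M, `CP(L^jη)^{−2}e^{−δ₂d(y,y″)}·CG(L^{j″}η)²e^{−δ₂d(y″,y′)}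
   ≤ CP·CG·L²·e^{−⅛δ₂mM}·e^{−¾δ₂d(y,y″)}e^{−¾δ₂d(y″,y′)}`: the ratio `(L^{j″}η/L^jη)²` is traded against `e^{−⅛δ₂d(y,y″)}` by
   (2.60) `LevelSep` under the threshold `L² ≤ e^{⅛δ₂RM}` (`B6Prop27Kernel.ratioP_mul_exp_le`) — *"the remarks after (2.68)"* —,
   one factor `e^{−⅛δ₂d(y,y″)} ≤ e^{−⅛δ₂mM}` is the gap, and `e^{−δ₂d(y″,y′)} ≤ e^{−¾δ₂d(y″,y′)}`.
§2 `sum_le` — the y″-SUM by Lemma 2.1 (2.63) at the rate ¾δ₂ with α = ⅓ (`Ineq263With c g (¾δ₂) (⅓)`, one intermediate point):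
   `Σ_{y″} e^{−¾δ₂d(y,y″)}e^{−¾δ₂d(y″,y′)} ≤ c²e^{−½δ₂d(y,y′)}` — the printed final rate ½δ₂.
§3 `offDiag_hasMajorant` — **(2.134) for □ ≠ □′**: `K_{□,□′}G_{□′}h_{□′} = a·∂P∂*·h_{□′}G_{□′}h_{□′}` has the block majorant
   `θ·e^{−½δ₂d(y,y′)}`, `θ = CP·CG·L²·c²·e^{−⅛δ₂mM}` (`hasMajorant_sandwich` + `hasMajorant_mul` + localisation + §1–§2), and
   `theta_le`: `θ ≤ (8·CP·CG·L²·c²/(δ₂m))·M⁻¹` — the printed O(M⁻¹); `offDiag_h2134` restates it in the exact hypothesis shape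
   `HasMajorant blk (Kt * mulOp h_{□′}) K` of `B6Prop26Gluing.majorant_R_of_2134`.
§4 `hasMajorant_of_kernel288` — the dictionary from the PRINTED pointwise (2.88) (kernel w.r.t. the η^d-pairing, factor
   `(L^{j″}η)^{−d}`) to the block majorant used in §3, through the block volumes `#B(y″)·η^d ≤ (L^{j″}η)^d`.
HONEST SCOPE.  (2.133) (Prop. 2.5) and (2.88) are the displayed HYPOTHESES in majorant form; the DIAGONAL family K_{□,□}
(lines 1–4 of (2.92): the local commutator terms, ζ_□(∂P∂* − ∂P_□∂*)h_□ = change of domain, ζ_□P_{□,1}(∂h_□)) is NOT treated here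
(its mechanisms are the entrywise certificates `…B6DomainChange`, `…B6Expansion282.line2Ker_abs_le`); the overlap/gluing to
(2.135) is `…B6Prop26Gluing`; the rate bookkeeping (⅛, ¾, ⅓) is ours — *"The choice of factors is again arbitrary"* (p. 238);
nothing on d = 4 or the continuum; NOT summit progress.
-/

namespace Literature.MathematicalPhysics.QuantumFieldTheory.Balaban1983to89.B6Ineq2134OffDiag

open B6RandomWalk B6Prop26Gluing Finset
open B6Ineq268 (mx LevelSep mx_nonneg mx_comm)
open B6Lemma21Repaired (Ineq263With)
open B6Prop27Kernel (ratioP ratioP_mul_exp_le ratioP_nonneg)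

variable {g : B6.Geometry} {X : Type}

/-! ## §1 One y″-term: power trading by (2.60), the gap, and the rate split -/

section Scalar

/-- `e^{−δt} = e^{−⅛δt}·e^{−⅛δt}·e^{−¾δt}`. [folklore] -/
private theorem exp_split (δ t : ℝ) :
    Real.exp (-(δ * t)) =
      Real.exp (-(1 / 8 * δ * t)) * Real.exp (-(1 / 8 * δ * t)) * Real.exp (-(3 / 4 * δ * t)) := by
  rw [← Real.exp_add, ← Real.exp_add]
  congr 1
  ring

/-- `(L^{j″}η)²/(L^jη)² = L^{2j″}/L^{2j}` = the scale weight `ratioP g 2 y″ y`. [cite: Balaban1984PropagatorsII, (2.68) p.235] -/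
private theorem len_sq_ratio (hL : 0 < g.L) (hη : 0 < g.eta) (y y'' : g.Site) :
    g.len y'' ^ 2 / g.len y ^ 2 = ratioP g 2 y'' y := by
  unfold B6.Geometry.len ratioP
  have hLy : g.L ^ g.scale y ≠ 0 := pow_ne_zero _ hL.ne'
  have hLy'' : g.L ^ g.scale y'' ≠ 0 := pow_ne_zero _ hL.ne'
  rw [mul_pow, mul_pow, ← pow_mul, ← pow_mul, mul_comm (g.scale y'') 2, mul_comm (g.scale y) 2]
  field_simp

/-- The symmetric reading of `mx`: `mx g y″ y = mx g y y″`. [folklore] -/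
private theorem mx_symm (y y'' : g.Site) : mx g y'' y = mx g y y'' := by
  rw [mx_comm y y'']
  rfl

/-- **ONE y″-TERM of (2.134)** (*"(2.133), (2.88) and the remarks after (2.68)"*): for `d(y,y″) ≥ m·M`,
`CP(L^jη)^{−2}e^{−δ₂d(y,y″)} · CG(L^{j″}η)²e^{−δ₂d(y″,y′)} ≤ CP·CG·L²·e^{−⅛δ₂mM}·e^{−¾δ₂d(y,y″)}·e^{−¾δ₂d(y″,y′)}` — the scale
ratio is absorbed by `e^{−⅛δ₂d(y,y″)}` through (2.60) and `L² ≤ e^{⅛δ₂RM}`, one more `e^{−⅛δ₂d(y,y″)}` is the small factor.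
[cite: Balaban1984PropagatorsII, (2.134) p.247] -/
theorem term_le (hL : 1 ≤ g.L) (hη : 0 < g.eta) (hsep : LevelSep g) (hd : ∀ a b, 0 ≤ g.dist a b)
    {δ₂ CP CG m : ℝ} (hδ₂ : 0 ≤ δ₂) (hCP : 0 ≤ CP) (hCG : 0 ≤ CG) (hRM : 0 ≤ g.R * g.M)
    (hthr : g.L ^ 2 ≤ Real.exp (1 / 8 * δ₂ * (g.R * g.M))) {y y'' : g.Site} (y' : g.Site)
    (hgap : m * g.M ≤ g.dist y y'') :
    CP / g.len y ^ 2 * Real.exp (-(δ₂ * g.dist y y'')) * (CG * g.len y'' ^ 2 * Real.exp (-(δ₂ * g.dist y'' y'))) ≤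
      CP * CG * g.L ^ 2 * Real.exp (-(1 / 8 * δ₂ * (m * g.M))) *
        (Real.exp (-(3 / 4 * δ₂ * g.dist y y'')) * Real.exp (-(3 / 4 * δ₂ * g.dist y'' y'))) := by
  have hL0 : 0 < g.L := zero_lt_one.trans_le hL
  have hlen : ∀ z : g.Site, 0 < g.len z := fun z => mul_pos (pow_pos hL0 _) hη
  -- the scale weight and its absorption: ratio·e^{−⅛δ₂d(y,y″)} ≤ L²
  have hβ : 0 ≤ 1 / 8 * δ₂ * (g.R * g.M) := by positivity
  have habs : ratioP g 2 y'' y * Real.exp (-(1 / 8 * δ₂ * g.dist y y'')) ≤ g.L ^ 2 := by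
    have h1 := ratioP_mul_exp_le (g := g) hL hβ 2 hthr y'' y
    have hmx : g.R * g.M * mx g y'' y ≤ g.dist y y'' := by rw [mx_symm]; exact hsep y y''
    have h2 : Real.exp (-(1 / 8 * δ₂ * g.dist y y'')) ≤ Real.exp (-(1 / 8 * δ₂ * (g.R * g.M) * mx g y'' y)) := by
      apply Real.exp_le_exp.mpr
      have : 1 / 8 * δ₂ * (g.R * g.M * mx g y'' y) ≤ 1 / 8 * δ₂ * g.dist y y'' :=
        mul_le_mul_of_nonneg_left hmx (by positivity)
      nlinarith
    exact (mul_le_mul_of_nonneg_left h2 (ratioP_nonneg hL0.le 2 y'' y)).trans h1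
  -- the gap factor
  have hgapE : Real.exp (-(1 / 8 * δ₂ * g.dist y y'')) ≤ Real.exp (-(1 / 8 * δ₂ * (m * g.M))) := by
    apply Real.exp_le_exp.mpr
    have : 1 / 8 * δ₂ * (m * g.M) ≤ 1 / 8 * δ₂ * g.dist y y'' := mul_le_mul_of_nonneg_left hgap (by positivity)
    linarith
  -- the last factor loses ¼ of its rate
  have hlast : Real.exp (-(δ₂ * g.dist y'' y')) ≤ Real.exp (-(3 / 4 * δ₂ * g.dist y'' y')) := by
    apply Real.exp_le_exp.mpr
    have := hd y'' y'
    nlinarith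
  -- assemble
  have hratio : CP / g.len y ^ 2 * (CG * g.len y'' ^ 2) = CP * CG * ratioP g 2 y'' y := by
    rw [← len_sq_ratio hL0 hη y y'']
    field_simp
  calc CP / g.len y ^ 2 * Real.exp (-(δ₂ * g.dist y y'')) * (CG * g.len y'' ^ 2 * Real.exp (-(δ₂ * g.dist y'' y')))
      = CP / g.len y ^ 2 * (CG * g.len y'' ^ 2) * Real.exp (-(δ₂ * g.dist y y'')) *
          Real.exp (-(δ₂ * g.dist y'' y')) := by ring
    _ = CP * CG * (ratioP g 2 y'' y * Real.exp (-(1 / 8 * δ₂ * g.dist y y''))) *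
          Real.exp (-(1 / 8 * δ₂ * g.dist y y'')) * Real.exp (-(3 / 4 * δ₂ * g.dist y y'')) *
          Real.exp (-(δ₂ * g.dist y'' y')) := by
        rw [hratio, exp_split δ₂ (g.dist y y'')]
        ring
    _ ≤ CP * CG * g.L ^ 2 * Real.exp (-(1 / 8 * δ₂ * (m * g.M))) * Real.exp (-(3 / 4 * δ₂ * g.dist y y'')) *
          Real.exp (-(3 / 4 * δ₂ * g.dist y'' y')) := by
        have hCC : 0 ≤ CP * CG := mul_nonneg hCP hCG
        gcongr
    _ = _ := by ring

end Scalar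

/-! ## §2 The y″-sum by Lemma 2.1 (2.63) at the rate ¾δ₂, α = ⅓ -/

section Sum

/-- **(2.63) with one intermediate point at the rate ¾δ₂, α = ⅓**: `Σ_{y″} e^{−¾δ₂d(y,y″)}e^{−¾δ₂d(y″,y′)} ≤ c²e^{−½δ₂d(y,y′)}`.
[cite: Balaban1984PropagatorsII, (2.63) p.234] -/
theorem sum_le {δ₂ c : ℝ} (h263 : Ineq263With c g (3 / 4 * δ₂) (1 / 3)) (y y' : g.Site) :
    ∑ y'' : g.Site, Real.exp (-(3 / 4 * δ₂ * g.dist y y'')) * Real.exp (-(3 / 4 * δ₂ * g.dist y'' y')) ≤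
      c ^ 2 * Real.exp (-(1 / 2 * δ₂ * g.dist y y')) := by
  have h := h263 1 y y'
  simp only [chain_succ, chain_zero] at h
  have hexp : Real.exp (-((1 - 1 / 3) * (3 / 4 * δ₂) * g.dist y y')) = Real.exp (-(1 / 2 * δ₂ * g.dist y y')) := by
    congr 1
    ring
  rw [hexp] at h
  exact h

end Sum

/-! ## §3 (2.134) for the off-diagonal pairs, as a block majorant -/

section Operator

/-- A left multiplication by a function with |a| ≤ 1 preserves a block majorant. [folklore] -/
private theorem hasMajorant_mulOp_left (blk : X → g.Site) {T : Module.End ℝ (X → ℝ)} {K : g.Site → g.Site → ℝ}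
    (hT : HasMajorant blk T K) {a : X → ℝ} (ha : ∀ x, |a x| ≤ 1) : HasMajorant blk (mulOp a * T) K := by
  intro y' μ B hμ x
  rw [Module.End.mul_apply, mulOp_apply, abs_mul]
  calc |a x| * |T μ x| ≤ 1 * |T μ x| := mul_le_mul_of_nonneg_right (ha x) (abs_nonneg _)
    _ = |T μ x| := one_mul _
    _ ≤ K (blk x) y' * B := hT y' μ B hμ x

/-- The operator `K_{□,□′}G_{□′}h_{□′} = a·∂P∂*·h_{□′}G_{□′}h_{□′}` written with the right factor `h_{□′}` split off (the shape
`Kt * mulOp h_{□′}` of `B6Prop26Gluing.majorant_R_of_2134`). [folklore] -/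
private theorem op_assoc (a hI : X → ℝ) (DP Gl : Module.End ℝ (X → ℝ)) :
    mulOp a * DP * (mulOp hI * Gl * mulOp hI) = mulOp a * DP * mulOp hI * Gl * mulOp hI := by
  simp only [mul_assoc]

/-- **(2.134), OFF-DIAGONAL PAIRS □ ≠ □′, KERNEL-CHECKED** in the block-majorant language: with the (2.88)-shape majorant
of ∂P∂* (`hP`), the (2.133)-shape local majorant of G_{□′} on its reach `S` (`hG`), |h_{□′}| ≤ 1 supported in the blocks of
`S`, |a| ≤ 1 (a = h_□²(1 − ζ_{□′})) vanishing on the blocks of the core `Score`, the gap `m·M` between `Scoreᶜ` and `S`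
(*"distance 1/3 M"*), (2.60) and `L² ≤ e^{⅛δ₂RM}`, and (2.63) at rate ¾δ₂, α = ⅓: the operator `a·∂P∂*·h_{□′}G_{□′}h_{□′}` has
the majorant `θ·e^{−½δ₂d(y,y′)}`, `θ = CP·CG·L²·c²·e^{−⅛δ₂mM}` (= O(M⁻¹), `theta_le`).
[cite: Balaban1984PropagatorsII, (2.134) p.247] -/
theorem offDiag_hasMajorant (blk : X → g.Site) (hL : 1 ≤ g.L) (hη : 0 < g.eta) (hsep : LevelSep g)
    (hd : ∀ a b, 0 ≤ g.dist a b) {δ₂ CP CG c m : ℝ} (hδ₂ : 0 ≤ δ₂) (hCP : 0 ≤ CP) (hCG : 0 ≤ CG)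
    (hRM : 0 ≤ g.R * g.M) (hthr : g.L ^ 2 ≤ Real.exp (1 / 8 * δ₂ * (g.R * g.M)))
    (h263 : Ineq263With c g (3 / 4 * δ₂) (1 / 3))
    {DP Gl : Module.End ℝ (X → ℝ)} {a hI : X → ℝ} {S Score : Set g.Site}
    (hP : HasMajorant blk DP fun y y'' => CP / g.len y ^ 2 * Real.exp (-(δ₂ * g.dist y y'')))
    (hG : LocalMajorant blk Gl S fun y'' y' => CG * g.len y'' ^ 2 * Real.exp (-(δ₂ * g.dist y'' y')))
    (ha1 : ∀ x, |a x| ≤ 1) (haS : ∀ x, a x ≠ 0 → blk x ∉ Score)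
    (hI1 : ∀ x, |hI x| ≤ 1) (hIS : ∀ x, hI x ≠ 0 → blk x ∈ S)
    (hgap : ∀ y y'', y ∉ Score → y'' ∈ S → m * g.M ≤ g.dist y y'') :
    HasMajorant blk (mulOp a * DP * (mulOp hI * Gl * mulOp hI)) fun y y' =>
      CP * CG * g.L ^ 2 * c ^ 2 * Real.exp (-(1 / 8 * δ₂ * (m * g.M))) *
        Real.exp (-(1 / 2 * δ₂ * g.dist y y')) := by
  classical
  have hL0 : 0 < g.L := zero_lt_one.trans_le hL
  have hlen : ∀ z : g.Site, 0 < g.len z := fun z => mul_pos (pow_pos hL0 _) hη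
  -- the majorants are non-negative
  have hKG : ∀ a b : g.Site, 0 ≤ CG * g.len a ^ 2 * Real.exp (-(δ₂ * g.dist a b)) := fun a b => by positivity
  have hKP : ∀ a b : g.Site, 0 ≤ CP / g.len a ^ 2 * Real.exp (-(δ₂ * g.dist a b)) := fun a b => by
    have := hlen a
    positivity
  -- (1) the sandwich h_{□′}G_{□′}h_{□′}
  have hS := hasMajorant_sandwich blk hKG hIS hI1 hG
  have hSnn : ∀ a b : g.Site, 0 ≤ ind S a * ind S b * (CG * g.len a ^ 2 * Real.exp (-(δ₂ * g.dist a b))) :=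
    fun a b => mul_nonneg (mul_nonneg (ind_nonneg _ _) (ind_nonneg _ _)) (hKG a b)
  -- (2) composition with ∂P∂*
  have hPS := hasMajorant_mul blk hP hS hSnn
  -- (3) the left factor a, and the localisation: output off the core, input in the reach
  have haT := hasMajorant_mulOp_left blk hPS ha1
  have hconv_nn : ∀ y y' : g.Site, 0 ≤ ∑ y'' : g.Site, CP / g.len y ^ 2 * Real.exp (-(δ₂ * g.dist y y'')) *
      (ind S y'' * ind S y' * (CG * g.len y'' ^ 2 * Real.exp (-(δ₂ * g.dist y'' y')))) :=
    fun y y' => Finset.sum_nonneg fun y'' _ => mul_nonneg (hKP y y'') (hSnn y'' y')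
  have hout : OutLoc blk (mulOp a * (DP * (mulOp hI * Gl * mulOp hI))) Scoreᶜ := by
    refine outLoc_mulOp_mul blk (fun x hx => ?_) _
    exact haS x hx
  have hin : InLoc blk (mulOp a * (DP * (mulOp hI * Gl * mulOp hI))) S := by
    have h1 : InLoc blk (mulOp a * DP * mulOp hI * Gl * mulOp hI) S := inLoc_mul_mulOp blk _ hIS
    have e : mulOp a * (DP * (mulOp hI * Gl * mulOp hI)) = mulOp a * DP * mulOp hI * Gl * mulOp hI := by
      simp only [mul_assoc]
    rw [e]
    exact h1
  have e0 : mulOp a * DP * (mulOp hI * Gl * mulOp hI) = mulOp a * (DP * (mulOp hI * Gl * mulOp hI)) := by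
    simp only [mul_assoc]
  rw [e0]
  have hloc := hasMajorant_localise blk haT hconv_nn hout hin
  -- (4) the pointwise bound of the localised majorant
  refine hasMajorant_mono blk hloc fun y y' => ?_
  set θ := CP * CG * g.L ^ 2 * c ^ 2 * Real.exp (-(1 / 8 * δ₂ * (m * g.M))) with hθ
  have hθnn : 0 ≤ θ := by positivity
  have hRHS : 0 ≤ θ * Real.exp (-(1 / 2 * δ₂ * g.dist y y')) := by positivity
  by_cases hy : y ∈ Score
  · have h0 : ind Scoreᶜ y = 0 := ind_of_not_mem (by simpa using hy)
    rw [h0, zero_mul, zero_mul]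
    exact hRHS
  -- y ∉ Score: every y″ ∈ S is at distance ≥ m·M
  have hind1 : ind Scoreᶜ y * ind S y' ≤ 1 :=
    (mul_le_mul (ind_le_one _ _) (ind_le_one _ _) (ind_nonneg _ _) zero_le_one).trans_eq (one_mul 1)
  have hterm : ∀ y'' : g.Site, CP / g.len y ^ 2 * Real.exp (-(δ₂ * g.dist y y'')) *
      (ind S y'' * ind S y' * (CG * g.len y'' ^ 2 * Real.exp (-(δ₂ * g.dist y'' y')))) ≤
      CP * CG * g.L ^ 2 * Real.exp (-(1 / 8 * δ₂ * (m * g.M))) *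
        (Real.exp (-(3 / 4 * δ₂ * g.dist y y'')) * Real.exp (-(3 / 4 * δ₂ * g.dist y'' y'))) := by
    intro y''
    by_cases hy'' : y'' ∈ S
    · have hg := hgap y y'' hy hy''
      have ht := term_le hL hη hsep hd hδ₂ hCP hCG hRM hthr y' hg
      have hii : ind S y'' * ind S y' ≤ 1 :=
        (mul_le_mul (ind_le_one _ _) (ind_le_one _ _) (ind_nonneg _ _) zero_le_one).trans_eq (one_mul 1)
      calc CP / g.len y ^ 2 * Real.exp (-(δ₂ * g.dist y y'')) *
            (ind S y'' * ind S y' * (CG * g.len y'' ^ 2 * Real.exp (-(δ₂ * g.dist y'' y'))))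
          = ind S y'' * ind S y' * (CP / g.len y ^ 2 * Real.exp (-(δ₂ * g.dist y y'')) *
              (CG * g.len y'' ^ 2 * Real.exp (-(δ₂ * g.dist y'' y')))) := by ring
        _ ≤ 1 * (CP / g.len y ^ 2 * Real.exp (-(δ₂ * g.dist y y'')) *
              (CG * g.len y'' ^ 2 * Real.exp (-(δ₂ * g.dist y'' y')))) :=
            mul_le_mul_of_nonneg_right hii (mul_nonneg (hKP y y'') (hKG y'' y'))
        _ ≤ _ := by rw [one_mul]; exact ht
    · rw [ind_of_not_mem hy'', zero_mul, zero_mul, mul_zero]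
      positivity
  calc ind Scoreᶜ y * ind S y' * ∑ y'' : g.Site, CP / g.len y ^ 2 * Real.exp (-(δ₂ * g.dist y y'')) *
          (ind S y'' * ind S y' * (CG * g.len y'' ^ 2 * Real.exp (-(δ₂ * g.dist y'' y'))))
      ≤ 1 * ∑ y'' : g.Site, CP / g.len y ^ 2 * Real.exp (-(δ₂ * g.dist y y'')) *
          (ind S y'' * ind S y' * (CG * g.len y'' ^ 2 * Real.exp (-(δ₂ * g.dist y'' y')))) :=
        mul_le_mul_of_nonneg_right hind1 (hconv_nn y y')
    _ ≤ ∑ y'' : g.Site, CP * CG * g.L ^ 2 * Real.exp (-(1 / 8 * δ₂ * (m * g.M))) *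
          (Real.exp (-(3 / 4 * δ₂ * g.dist y y'')) * Real.exp (-(3 / 4 * δ₂ * g.dist y'' y'))) := by
        rw [one_mul]
        exact Finset.sum_le_sum fun y'' _ => hterm y''
    _ = CP * CG * g.L ^ 2 * Real.exp (-(1 / 8 * δ₂ * (m * g.M))) *
          ∑ y'' : g.Site, Real.exp (-(3 / 4 * δ₂ * g.dist y y'')) * Real.exp (-(3 / 4 * δ₂ * g.dist y'' y')) := by
        rw [Finset.mul_sum]
    _ ≤ CP * CG * g.L ^ 2 * Real.exp (-(1 / 8 * δ₂ * (m * g.M))) * (c ^ 2 * Real.exp (-(1 / 2 * δ₂ * g.dist y y'))) :=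
        mul_le_mul_of_nonneg_left (sum_le h263 y y') (by positivity)
    _ = θ * Real.exp (-(1 / 2 * δ₂ * g.dist y y')) := by rw [hθ]; ring

/-- **The printed O(M⁻¹)**: `θ = CP·CG·L²·c²·e^{−⅛δ₂mM} ≤ (8·CP·CG·L²·c²/(δ₂m))·M⁻¹` (from `1 + t ≤ e^t`), for `δ₂, m, M > 0`.
[cite: Balaban1984PropagatorsII, (2.134) p.247] -/
theorem theta_le {δ₂ CP CG c m L M : ℝ} (hδ₂ : 0 < δ₂) (hm : 0 < m) (hM : 0 < M) (hCP : 0 ≤ CP) (hCG : 0 ≤ CG) :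
    CP * CG * L ^ 2 * c ^ 2 * Real.exp (-(1 / 8 * δ₂ * (m * M))) ≤
      8 * CP * CG * L ^ 2 * c ^ 2 / (δ₂ * m) * M⁻¹ := by
  have ht : 0 < 1 / 8 * δ₂ * (m * M) := by positivity
  have hexp : Real.exp (-(1 / 8 * δ₂ * (m * M))) ≤ (1 / 8 * δ₂ * (m * M))⁻¹ := by
    rw [Real.exp_neg]
    have hle : 1 / 8 * δ₂ * (m * M) ≤ Real.exp (1 / 8 * δ₂ * (m * M)) := by
      linarith [Real.add_one_le_exp (1 / 8 * δ₂ * (m * M))]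
    exact inv_anti₀ ht hle
  have hK : 0 ≤ CP * CG * L ^ 2 * c ^ 2 := by positivity
  calc CP * CG * L ^ 2 * c ^ 2 * Real.exp (-(1 / 8 * δ₂ * (m * M)))
      ≤ CP * CG * L ^ 2 * c ^ 2 * (1 / 8 * δ₂ * (m * M))⁻¹ := mul_le_mul_of_nonneg_left hexp hK
    _ = 8 * CP * CG * L ^ 2 * c ^ 2 / (δ₂ * m) * M⁻¹ := by
        field_simp

/-- **(2.134) in the hypothesis shape of `B6Prop26Gluing.majorant_R_of_2134`** (`HasMajorant blk (Kt * mulOp h_{□′}) K` with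
`Kt = a·∂P∂*·h_{□′}·G_{□′}`), for the off-diagonal pairs. [cite: Balaban1984PropagatorsII, (2.134) p.247] -/
theorem offDiag_h2134 (blk : X → g.Site) (hL : 1 ≤ g.L) (hη : 0 < g.eta) (hsep : LevelSep g)
    (hd : ∀ a b, 0 ≤ g.dist a b) {δ₂ CP CG c m : ℝ} (hδ₂ : 0 ≤ δ₂) (hCP : 0 ≤ CP) (hCG : 0 ≤ CG)
    (hRM : 0 ≤ g.R * g.M) (hthr : g.L ^ 2 ≤ Real.exp (1 / 8 * δ₂ * (g.R * g.M)))
    (h263 : Ineq263With c g (3 / 4 * δ₂) (1 / 3))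
    {DP Gl : Module.End ℝ (X → ℝ)} {a hI : X → ℝ} {S Score : Set g.Site}
    (hP : HasMajorant blk DP fun y y'' => CP / g.len y ^ 2 * Real.exp (-(δ₂ * g.dist y y'')))
    (hG : LocalMajorant blk Gl S fun y'' y' => CG * g.len y'' ^ 2 * Real.exp (-(δ₂ * g.dist y'' y')))
    (ha1 : ∀ x, |a x| ≤ 1) (haS : ∀ x, a x ≠ 0 → blk x ∉ Score)
    (hI1 : ∀ x, |hI x| ≤ 1) (hIS : ∀ x, hI x ≠ 0 → blk x ∈ S)
    (hgap : ∀ y y'', y ∉ Score → y'' ∈ S → m * g.M ≤ g.dist y y'') :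
    HasMajorant blk ((mulOp a * DP * mulOp hI * Gl) * mulOp hI) fun y y' =>
      CP * CG * g.L ^ 2 * c ^ 2 * Real.exp (-(1 / 8 * δ₂ * (m * g.M))) *
        Real.exp (-(1 / 2 * δ₂ * g.dist y y')) := by
  have h := offDiag_hasMajorant blk hL hη hsep hd hδ₂ hCP hCG hRM hthr h263 hP hG ha1 haS hI1 hIS hgap
  rw [op_assoc] at h
  exact h

end Operator

/-! ## §4 From the printed pointwise (2.88) to the block majorant of ∂P∂* -/

section Kernel288

open Classical in
/-- **The dictionary for (2.88)**: an operator with kernel `k` in the η^d-pairing, `(Tv)(x) = Σ_{x′} η^d k(x,x′)v(x′)`, whose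
kernel obeys the printed `|k(x,x′)| ≤ CP·(L^jη)^{−2}(L^{j′}η)^{−d}e^{−δ₂d(y,y′)}` (x ∈ B^j(y), x′ ∈ B^{j′}(y′)), has the block
majorant `CP·(L^jη)^{−2}e^{−δ₂d(y,y′)}` as soon as each block carries the volume `#B(y′)·η^d ≤ (L^{j′}η)^d` — the
hypothesis `hP` of §3. [cite: Balaban1984PropagatorsII, (2.88) p.238] -/
theorem hasMajorant_of_kernel288 [Fintype X] (blk : X → g.Site) (hL : 0 < g.L) (hη : 0 < g.eta) (d : ℕ)
    (T : Module.End ℝ (X → ℝ)) (k : X → X → ℝ) {w CP δ₂ : ℝ} (hw : 0 ≤ w) (hCP : 0 ≤ CP)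
    (hT : ∀ (v : X → ℝ) (x : X), T v x = ∑ x', w * k x x' * v x')
    (hvol : ∀ y' : g.Site, ((Finset.univ.filter fun x' => blk x' = y').card : ℝ) * w ≤ g.len y' ^ d)
    (hk : ∀ x x', |k x x'| ≤
      CP / g.len (blk x) ^ 2 / g.len (blk x') ^ d * Real.exp (-(δ₂ * g.dist (blk x) (blk x')))) :
    HasMajorant blk T fun y y' => CP / g.len y ^ 2 * Real.exp (-(δ₂ * g.dist y y')) := by
  intro y' μ B hμ x
  have hlen : ∀ z : g.Site, 0 < g.len z := fun z => mul_pos (pow_pos hL _) hη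
  rw [hT μ x]
  -- only the block of y′ contributes
  have hsplit : ∑ x', w * k x x' * μ x' = ∑ x' ∈ Finset.univ.filter (fun x' => blk x' = y'), w * k x x' * μ x' := by
    rw [Finset.sum_filter]
    refine Finset.sum_congr rfl fun x' _ => ?_
    split_ifs with h
    · rfl
    · rw [hμ.off x' h, mul_zero]
  rw [hsplit]
  set Kxy := CP / g.len (blk x) ^ 2 / g.len y' ^ d * Real.exp (-(δ₂ * g.dist (blk x) y')) with hKxy
  have hKnn : 0 ≤ Kxy := by
    have := hlen (blk x)
    have := hlen y'
    positivity
  have hterm : ∀ x' ∈ Finset.univ.filter (fun x' => blk x' = y'), |w * k x x' * μ x'| ≤ w * Kxy * B := by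
    intro x' hx'
    have hb : blk x' = y' := (Finset.mem_filter.mp hx').2
    rw [abs_mul, abs_mul, abs_of_nonneg hw]
    have h1 : |k x x'| ≤ Kxy := by rw [hKxy, ← hb]; exact hk x x'
    have h2 : |μ x'| ≤ B := hμ.bound x' hb
    calc w * |k x x'| * |μ x'| ≤ w * Kxy * B :=
        mul_le_mul (mul_le_mul_of_nonneg_left h1 hw) h2 (abs_nonneg _) (mul_nonneg hw hKnn)
      _ = w * Kxy * B := rfl
  calc |∑ x' ∈ Finset.univ.filter (fun x' => blk x' = y'), w * k x x' * μ x'|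
      ≤ ∑ x' ∈ Finset.univ.filter (fun x' => blk x' = y'), |w * k x x' * μ x'| := Finset.abs_sum_le_sum_abs _ _
    _ ≤ ∑ x' ∈ Finset.univ.filter (fun x' => blk x' = y'), w * Kxy * B := Finset.sum_le_sum hterm
    _ = ((Finset.univ.filter fun x' => blk x' = y').card : ℝ) * w * (Kxy * B) := by
        rw [Finset.sum_const, nsmul_eq_mul]
        ring
    _ ≤ g.len y' ^ d * (Kxy * B) := mul_le_mul_of_nonneg_right (hvol y') (mul_nonneg hKnn hμ.nonneg)
    _ = CP / g.len (blk x) ^ 2 * Real.exp (-(δ₂ * g.dist (blk x) y')) * B := by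
        rw [hKxy]
        have hly : g.len y' ^ d ≠ 0 := pow_ne_zero _ (hlen y').ne'
        field_simp

end Kernel288

end Literature.MathematicalPhysics.QuantumFieldTheory.Balaban1983to89.B6Ineq2134OffDiag
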